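/- Extra width seat `ym-line-cbag-p1-w4` (prover-ym-line-cbag-p1-w4-g0-0; own crux stmt-QuantumFields-22254 closed) of the cell of
ideator ym-idea-2: glue for LINE 7, route `GlueballBandRecursion` — part 1/2 of the RATE DICTIONARY (pure real analysis). -/
import Mathlib

/-!
# Route `GlueballBandRecursion` (LINE 7 of ideator ym-idea-2): power sums of a non-negative family — the `ℓᵖ → ℓ^∞` lemma

Part 1/2 of the rate dictionary for the route's finite-volume rate `q_N = ⨅ₖ x_{k+2}(N)^{1/(k+2)}` (part 2/2:
`GlueballBandRecursionRateDictionary.lean`, which specialises everything below to the thermal trace excess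
`x_{m+2}(N) = Σ_{i ≠ i₀} (λᵢ/λ₀)^{m+2}` of the `N³` Wilson transfer matrix).  Pure real analysis, no gauge theory:
for a non-negative real family `c : κ → ℝ` whose power sums `X m = Σᵢ cᵢ^{m+2}` exist for every `m` (`HasSum`),

* `PowerSum.le_root` — `cᵢ ≤ (X m)^{1/(m+2)}`; `PowerSum.succ_le` / `add_le` — `X (m+j) ≤ (⨆ c)^j · X m`;
* `PowerSum.root_antitone` — `m ↦ (X m)^{1/(m+2)}` is antitone (monotonicity of `ℓᵖ` norms), `PowerSum.tendsto_root` — it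
  converges to its infimum;
* `PowerSum.iInf_root_eq_iSup` — the IDENTIFICATION `⨅ₘ (X m)^{1/(m+2)} = ⨆ᵢ cᵢ` (easy half `le_ciInf`; hard half from
  `X j ≤ (⨆ c)^j X 0`, `(2+j)`-th roots and `j → ∞`), with the usable corollaries `le_iInf_root` (`cᵢ ≤ ⨅ roots`),
  `iInf_root_le_of_forall_le` (`⨅ roots ≤ B` once `c ≤ B`, `B ≥ 0`), `add_le_iInf_root_pow_mul` (exact-rate decay
  `X (m+j) ≤ (⨅ roots)^j X m`) and `iInf_root_pow_le` (`(⨅ roots)^{m+2} ≤ X m`).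

[folklore]  HONEST FRAMING: bookkeeping for an at-risk DRAFT line onto a strong-coupling RECORD-type rung; nothing here is
about Yang–Mills, and the mass gap (Clay) is NOT proved by anything in this file.
-/

set_option autoImplicit false

noncomputable section

open Filter Topology

namespace Summit.QuantumFields.YangMills.Theorems.GlueballBandRecursion

/-! ## §1 Power sums of a non-negative family (pure real analysis) -/

namespace PowerSum

variable {κ : Type*} {c : κ → ℝ} {X : ℕ → ℝ}

/-- Each power sum is non-negative. -/
theorem nonneg (hc : ∀ i, 0 ≤ c i) (hX : ∀ m, HasSum (fun i => c i ^ (m + 2)) (X m)) (m : ℕ) : 0 ≤ X m :=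
  (hX m).nonneg fun i => pow_nonneg (hc i) _

/-- Each term is dominated by the power sum. -/
theorem pow_le (hc : ∀ i, 0 ≤ c i) (hX : ∀ m, HasSum (fun i => c i ^ (m + 2)) (X m)) (i : κ) (m : ℕ) :
    c i ^ (m + 2) ≤ X m :=
  le_hasSum (hX m) i fun j _ => pow_nonneg (hc j) _

/-- Each member of the family is dominated by every root `(X m)^{1/(m+2)}`. -/
theorem le_root (hc : ∀ i, 0 ≤ c i) (hX : ∀ m, HasSum (fun i => c i ^ (m + 2)) (X m)) (i : κ) (m : ℕ) :
    c i ≤ X m ^ ((1 : ℝ) / ((m : ℝ) + 2)) := by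
  have h1 : c i = (c i ^ (m + 2)) ^ ((1 : ℝ) / ((m : ℝ) + 2)) := by
    rw [one_div, show ((m : ℝ) + 2) = ((m + 2 : ℕ) : ℝ) by push_cast; ring,
      Real.pow_rpow_inv_natCast (hc i) (by omega)]
  rw [h1]
  exact Real.rpow_le_rpow (pow_nonneg (hc i) _) (pow_le hc hX i m) (by positivity)

/-- The family is bounded above (by `(X 0)^{1/2}`). -/
theorem bddAbove_range (hc : ∀ i, 0 ≤ c i) (hX : ∀ m, HasSum (fun i => c i ^ (m + 2)) (X m)) :
    BddAbove (Set.range c) :=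
  ⟨X 0 ^ ((1 : ℝ) / ((0 : ℕ) + 2 : ℝ)), by rintro _ ⟨i, rfl⟩; exact_mod_cast le_root hc hX i 0⟩

/-- The supremum of the family is non-negative. -/
theorem iSup_nonneg' (hc : ∀ i, 0 ≤ c i) : 0 ≤ ⨆ i, c i := Real.iSup_nonneg hc

/-- Each member is at most the supremum. -/
theorem le_iSup' (hc : ∀ i, 0 ≤ c i) (hX : ∀ m, HasSum (fun i => c i ^ (m + 2)) (X m)) (i : κ) :
    c i ≤ ⨆ j, c j := le_ciSup (bddAbove_range hc hX) i

/-- The supremum is dominated by every root. -/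
theorem iSup_le_root (hc : ∀ i, 0 ≤ c i) (hX : ∀ m, HasSum (fun i => c i ^ (m + 2)) (X m)) (m : ℕ) :
    (⨆ i, c i) ≤ X m ^ ((1 : ℝ) / ((m : ℝ) + 2)) :=
  Real.iSup_le (fun i => le_root hc hX i m) (Real.rpow_nonneg (nonneg hc hX m) _)

/-- One more power costs a factor `sup c`: `X (m+1) ≤ (⨆ c) · X m`. -/
theorem succ_le (hc : ∀ i, 0 ≤ c i) (hX : ∀ m, HasSum (fun i => c i ^ (m + 2)) (X m)) (m : ℕ) :
    X (m + 1) ≤ (⨆ i, c i) * X m := by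
  refine hasSum_le (fun i => ?_) (hX (m + 1)) ((hX m).mul_left _)
  rw [show m + 1 + 2 = (m + 2) + 1 by ring, pow_succ, mul_comm]
  exact mul_le_mul_of_nonneg_right (le_iSup' hc hX i) (pow_nonneg (hc i) _)

/-- `j` more powers cost a factor `(sup c)^j`: `X (m+j) ≤ (⨆ c)^j · X m`. -/
theorem add_le (hc : ∀ i, 0 ≤ c i) (hX : ∀ m, HasSum (fun i => c i ^ (m + 2)) (X m)) (m j : ℕ) :
    X (m + j) ≤ (⨆ i, c i) ^ j * X m := by
  induction j with
  | zero => simp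
  | succ j ih =>
    calc X (m + (j + 1)) = X (m + j + 1) := by rw [Nat.add_assoc]
      _ ≤ (⨆ i, c i) * X (m + j) := succ_le hc hX (m + j)
      _ ≤ (⨆ i, c i) * ((⨆ i, c i) ^ j * X m) := mul_le_mul_of_nonneg_left ih (iSup_nonneg' hc)
      _ = (⨆ i, c i) ^ (j + 1) * X m := by ring

/-- The roots decrease: `(X (m+1))^{1/(m+3)} ≤ (X m)^{1/(m+2)}` (`X (m+1) ≤ (⨆ c)·X m ≤ (X m)^{1/(m+2)}·X m`). -/
theorem root_succ_le (hc : ∀ i, 0 ≤ c i) (hX : ∀ m, HasSum (fun i => c i ^ (m + 2)) (X m)) (m : ℕ) :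
    X (m + 1) ^ ((1 : ℝ) / (((m + 1 : ℕ) : ℝ) + 2)) ≤ X m ^ ((1 : ℝ) / ((m : ℝ) + 2)) := by
  have hXm := nonneg hc hX m
  have hXm1 := nonneg hc hX (m + 1)
  have h1 : X (m + 1) ≤ X m ^ ((1 : ℝ) / ((m : ℝ) + 2)) * X m :=
    (succ_le hc hX m).trans (mul_le_mul_of_nonneg_right (iSup_le_root hc hX m) hXm)
  have h2 : X m ^ ((1 : ℝ) / ((m : ℝ) + 2)) * X m = X m ^ (((m : ℝ) + 3) / ((m : ℝ) + 2)) := by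
    have : ((m : ℝ) + 3) / ((m : ℝ) + 2) = 1 / ((m : ℝ) + 2) + 1 := by
      field_simp
      ring
    rw [this, Real.rpow_add' hXm (by positivity), Real.rpow_one]
  rw [h2] at h1
  have h3 : X (m + 1) ^ ((1 : ℝ) / (((m + 1 : ℕ) : ℝ) + 2)) ≤
      (X m ^ (((m : ℝ) + 3) / ((m : ℝ) + 2))) ^ ((1 : ℝ) / (((m + 1 : ℕ) : ℝ) + 2)) :=
    Real.rpow_le_rpow hXm1 h1 (by positivity)
  refine h3.trans_eq ?_
  rw [← Real.rpow_mul hXm]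
  congr 1
  push_cast
  field_simp
  ring

/-- The root sequence `m ↦ (X m)^{1/(m+2)}` is antitone (monotonicity of `ℓᵖ` norms). -/
theorem root_antitone (hc : ∀ i, 0 ≤ c i) (hX : ∀ m, HasSum (fun i => c i ^ (m + 2)) (X m)) :
    Antitone (fun m : ℕ => X m ^ ((1 : ℝ) / ((m : ℝ) + 2))) :=
  antitone_nat_of_succ_le fun m => root_succ_le hc hX m

/-- The root sequence is bounded below (by `0`). -/
theorem bddBelow_range_root (hc : ∀ i, 0 ≤ c i) (hX : ∀ m, HasSum (fun i => c i ^ (m + 2)) (X m)) :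
    BddBelow (Set.range fun m : ℕ => X m ^ ((1 : ℝ) / ((m : ℝ) + 2))) :=
  ⟨0, by rintro _ ⟨k, rfl⟩; exact Real.rpow_nonneg (nonneg hc hX k) _⟩

/-- The infimum of the roots lies below every root: `⨅ ≤ (X m)^{1/(m+2)}`. -/
theorem iInf_root_le (hc : ∀ i, 0 ≤ c i) (hX : ∀ m, HasSum (fun i => c i ^ (m + 2)) (X m)) (m : ℕ) :
    (⨅ k : ℕ, X k ^ ((1 : ℝ) / ((k : ℝ) + 2))) ≤ X m ^ ((1 : ℝ) / ((m : ℝ) + 2)) :=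
  ciInf_le (bddBelow_range_root hc hX) m

/-- The infimum of the roots is non-negative. -/
theorem iInf_root_nonneg (hc : ∀ i, 0 ≤ c i) (hX : ∀ m, HasSum (fun i => c i ^ (m + 2)) (X m)) :
    0 ≤ ⨅ k : ℕ, X k ^ ((1 : ℝ) / ((k : ℝ) + 2)) :=
  Real.iInf_nonneg fun k => Real.rpow_nonneg (nonneg hc hX k) _

/-- The roots converge to their infimum. -/
theorem tendsto_root (hc : ∀ i, 0 ≤ c i) (hX : ∀ m, HasSum (fun i => c i ^ (m + 2)) (X m)) :
    Tendsto (fun m : ℕ => X m ^ ((1 : ℝ) / ((m : ℝ) + 2))) atTop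
      (𝓝 (⨅ k : ℕ, X k ^ ((1 : ℝ) / ((k : ℝ) + 2)))) :=
  tendsto_atTop_ciInf (root_antitone hc hX) (bddBelow_range_root hc hX)

/-- EASY HALF of the identification: `⨆ c ≤ ⨅ₘ (X m)^{1/(m+2)}`. -/
theorem iSup_le_iInf_root (hc : ∀ i, 0 ≤ c i) (hX : ∀ m, HasSum (fun i => c i ^ (m + 2)) (X m)) :
    (⨆ i, c i) ≤ ⨅ k : ℕ, X k ^ ((1 : ℝ) / ((k : ℝ) + 2)) :=
  le_ciInf fun m => iSup_le_root hc hX m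

/-- Each member of the family is dominated by the infimum of the roots. -/
theorem le_iInf_root (hc : ∀ i, 0 ≤ c i) (hX : ∀ m, HasSum (fun i => c i ^ (m + 2)) (X m)) (i : κ) :
    c i ≤ ⨅ k : ℕ, X k ^ ((1 : ℝ) / ((k : ℝ) + 2)) :=
  (le_iSup' hc hX i).trans (iSup_le_iInf_root hc hX)

/-- HARD HALF of the identification: `⨅ₘ (X m)^{1/(m+2)} ≤ ⨆ c` (`X j ≤ (⨆ c)^j·X 0`, take roots, let `j → ∞`). -/
theorem iInf_root_le_iSup (hc : ∀ i, 0 ≤ c i) (hX : ∀ m, HasSum (fun i => c i ^ (m + 2)) (X m)) :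
    (⨅ k : ℕ, X k ^ ((1 : ℝ) / ((k : ℝ) + 2))) ≤ ⨆ i, c i := by
  set M : ℝ := ⨆ i, c i with hM
  have hM0 : 0 ≤ M := iSup_nonneg' hc
  have hroot_le : ∀ j : ℕ, X j ^ ((1 : ℝ) / ((j : ℝ) + 2)) ≤ (M ^ j * X 0) ^ ((1 : ℝ) / ((j : ℝ) + 2)) :=
    fun j => Real.rpow_le_rpow (nonneg hc hX j) (by simpa using add_le hc hX 0 j) (by positivity)
  rcases (nonneg hc hX 0).eq_or_lt with h0 | h0
  · calc (⨅ k : ℕ, X k ^ ((1 : ℝ) / ((k : ℝ) + 2))) ≤ X 0 ^ ((1 : ℝ) / (((0 : ℕ) : ℝ) + 2)) :=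
          iInf_root_le hc hX 0
      _ = 0 := by rw [← h0]; exact Real.zero_rpow (by norm_num)
      _ ≤ M := hM0
  · have h1 : Tendsto (fun j : ℕ => (j : ℝ) / ((j : ℝ) + 2)) atTop (𝓝 1) := tendsto_natCast_div_add_atTop 2
    have h2 : Tendsto (fun j : ℕ => (1 : ℝ) / ((j : ℝ) + 2)) atTop (𝓝 0) := by
      have h := (tendsto_one_div_add_atTop_nhds_zero_nat (𝕜 := ℝ)).comp (tendsto_add_atTop_nat 1)
      refine h.congr fun j => ?_
      simp only [Function.comp_apply]
      push_cast
      ring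
    have hA : Tendsto (fun j : ℕ => M ^ ((j : ℝ) / ((j : ℝ) + 2))) atTop (𝓝 (M ^ (1 : ℝ))) :=
      tendsto_const_nhds.rpow h1 (Or.inr one_pos)
    have hB : Tendsto (fun j : ℕ => X 0 ^ ((1 : ℝ) / ((j : ℝ) + 2))) atTop (𝓝 (X 0 ^ (0 : ℝ))) :=
      tendsto_const_nhds.rpow h2 (Or.inl h0.ne')
    rw [Real.rpow_one] at hA
    rw [Real.rpow_zero] at hB
    have hlim : Tendsto (fun j : ℕ => (M ^ j * X 0) ^ ((1 : ℝ) / ((j : ℝ) + 2))) atTop (𝓝 M) := by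
      have e : ∀ j : ℕ, (M ^ j * X 0) ^ ((1 : ℝ) / ((j : ℝ) + 2)) =
          M ^ ((j : ℝ) / ((j : ℝ) + 2)) * X 0 ^ ((1 : ℝ) / ((j : ℝ) + 2)) := by
        intro j
        rw [Real.mul_rpow (pow_nonneg hM0 _) h0.le, ← Real.rpow_natCast, ← Real.rpow_mul hM0]
        congr 2
        field_simp
      simp_rw [e]
      simpa using hA.mul hB
    exact ge_of_tendsto' hlim fun j => (iInf_root_le hc hX j).trans (hroot_le j)

/-- **Identification**: the infimum (= limit) of the roots of the power sums is the supremum of the family,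
`⨅ₘ (Σᵢ cᵢ^{m+2})^{1/(m+2)} = ⨆ᵢ cᵢ` — the `ℓᵖ → ℓ^∞` limit for a square-summable non-negative family. -/
theorem iInf_root_eq_iSup (hc : ∀ i, 0 ≤ c i) (hX : ∀ m, HasSum (fun i => c i ^ (m + 2)) (X m)) :
    (⨅ k : ℕ, X k ^ ((1 : ℝ) / ((k : ℝ) + 2))) = ⨆ i, c i :=
  le_antisymm (iInf_root_le_iSup hc hX) (iSup_le_iInf_root hc hX)

/-- The infimum of the roots is dominated by every non-negative bound of the family. -/
theorem iInf_root_le_of_forall_le (hc : ∀ i, 0 ≤ c i) (hX : ∀ m, HasSum (fun i => c i ^ (m + 2)) (X m))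
    {B : ℝ} (hB : 0 ≤ B) (h : ∀ i, c i ≤ B) : (⨅ k : ℕ, X k ^ ((1 : ℝ) / ((k : ℝ) + 2))) ≤ B :=
  (iInf_root_le_iSup hc hX).trans (Real.iSup_le h hB)

/-- **Exact-rate decay**: `X (m+j) ≤ (⨅ₖ (X k)^{1/(k+2)})^j · X m` — `j` further powers cost the `j`-th power of the rate. -/
theorem add_le_iInf_root_pow_mul (hc : ∀ i, 0 ≤ c i) (hX : ∀ m, HasSum (fun i => c i ^ (m + 2)) (X m))
    (m j : ℕ) : X (m + j) ≤ (⨅ k : ℕ, X k ^ ((1 : ℝ) / ((k : ℝ) + 2))) ^ j * X m :=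
  (add_le hc hX m j).trans (mul_le_mul_of_nonneg_right
    (pow_le_pow_left₀ (iSup_nonneg' hc) (iSup_le_iInf_root hc hX) j) (nonneg hc hX m))

/-- The `(m+2)`-nd power of the rate is dominated by the `m`-th power sum. -/
theorem iInf_root_pow_le (hc : ∀ i, 0 ≤ c i) (hX : ∀ m, HasSum (fun i => c i ^ (m + 2)) (X m)) (m : ℕ) :
    (⨅ k : ℕ, X k ^ ((1 : ℝ) / ((k : ℝ) + 2))) ^ (m + 2) ≤ X m := by
  have h := pow_le_pow_left₀ (iInf_root_nonneg hc hX) (iInf_root_le hc hX m) (m + 2)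
  refine h.trans_eq ?_
  rw [one_div, show ((m : ℝ) + 2) = ((m + 2 : ℕ) : ℝ) by push_cast; ring]
  exact Real.rpow_inv_natCast_pow (nonneg hc hX m) (by omega)

end PowerSum

end Summit.QuantumFields.YangMills.Theorems.GlueballBandRecursion

end
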